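import Literature.MathematicalPhysics.QuantumFieldTheory.IsotropicOSFamilyExists
import Literature.MathematicalPhysics.QuantumFieldTheory.OSAxiomsFreeFieldMassGapProofs
import Literature.MathematicalPhysics.QuantumFieldTheory.OSAxiomsFreeFieldOSMeasureProofs
import Literature.MathematicalPhysics.QuantumFieldTheory.OSAxiomsOSFamilyProofs
import HarnessLib

/-!
# Discharge of `IsotropicOSFamilyExists`: the free scalar field on `ℝ⁴` as a labelled OS family

No named facts. Main result:

* `isotropicOSFamilyExists_holds : IsotropicOSFamilyExists` — the named fact of
  `Literature/MathematicalPhysics/QuantumFieldTheory/IsotropicOSFamilyExists.lean` (consumed by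
  `Summits/QuantumFields/YangMills/Theorems/CurvatureAmnesia/Negative/ModelBlindFalse.lean`): there is
  a one-field Schwinger family on `ℝ⁴` whose `Unit`-labelled family is normalised, hermitian, of
  linear growth, reflection positive, symmetric, clustering, invariant under all translations and
  linear isometries, has `HasMassGap Δ` for some `Δ > 0`, and has a non-vanishing truncated two-point
  function at a reflected pair. Witness: the Schwinger family of the free field measure of mass `1`
  (`freeFieldMeasure 4 1`, tree `freeFieldMeasure_spec_holds`, `IsFreeField.isOSMeasure_holds`,
  `IsOSMeasure.exists_isOSFamily'_holds`).

The four items listed as missing in the fact's module docstring are supplied as follows.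

1. Bridges one-field → labelled: E0 (normalisation), E3, E4, E0' are direct
   (`isNormalized_toLabelled`, `isSymmetric_toLabelled`, `hasClusterProperty_toLabelled`,
   `hasLinearGrowth_toLabelled`; E0' from the tree's product growth
   `IsOSMeasure.hasProductGrowth` + `HasProductGrowth.hasLinearGrowth_holds`); E2 in the finite-family
   form with arbitrary degrees (`IsSchwingerFamilyOf.isReflectionPositive_toLabelled`) is OS3 on field
   polynomials (tree `IsSchwingerFamilyOf.sum_sum_osPairing_nonneg`, Glimm–Jaffe Prop. 6.1.4) extended
   by the density of positive-time tensor products and continuity of the OS form — the argument of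
   the tree's `isOSReflectionPositive_of_closure` with a general index.
2. Hermiticity (`IsSchwingerFamilyOf.isHermitian_toLabelled`): reality of the moments of a measure,
   `𝔖ₙ(F*) = conj 𝔖ₙ(F)` for all `F` (`IsSchwingerFamilyOf.apply_osStar_eq_conj`, by density of real
   tensor products), plus reflection invariance (E1).
3. Mass gap for all truncations: `IsFreeField.hasMassGap_toLabelled`
   (`OSAxiomsFreeFieldMassGapProofs`, Glimm–Jaffe Thm. 6.2.4 / Cor. 6.2.7).
4. Non-triviality (`IsFreeField.exists_truncated_two_point_ne`): for a nonnegative positive-time bump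
   `u`, `𝔖₂(Θu* ⊗ u) = C_m(θu, u) > 0` (`freeCovarianceReal_thetaTest_self_pos`: in the momentum form
   (6.2.15) of the tree, `C_m(θu, u) = ∫ (2ω)⁻¹ |G_u|² dη` with `G_u` continuous and
   `G_u(0) = ∫ e^{−m y⁰} u > 0`), while `𝔖₁ = 0` (the free field is centred).

Further results (general dimension `d ≥ 1` and mass `m > 0`):

* `exists_isotropicOSFamily_freeField d hm` — all the clauses above for the Schwinger family of
  `freeFieldMeasure d m`, with `MassGapOS m` / `HasMassGap m`;
* `freeFieldSchwinger d hm` (a choice of that family) and `freeFieldOSData d hm : OSData Unit d` — the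
  free scalar field as OS data, a NON-trivial inhabitant of `OSData` (compare `OSData.vacuum`):
  `freeFieldOSData_hasMassGap`, `freeFieldOSData_isNontrivial`,
  `exists_osData_hasMassGap_isNontrivial`;
* `not_isNonGaussian_freeFieldOSData` — it fails `OSData.IsNonGaussian` (odd moments of the centred
  Gaussian vanish: `IsFreeField.moment_three_eq_zero`, `IsFreeField.apply_three_eq_zero`,
  `IsFreeField.apply_one_eq_zero`, via Stein's identity `integral_coord_mul_eval_γm` on the
  finite-dimensional marginals `IsFreeField.integral_comp_evalVec`), so that clause of the summit
  statements separates "massive and non-trivial" from "interacting".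

## References

* J. Glimm, A. Jaffe, *Quantum Physics: a functional integral point of view*, 2nd ed., Springer
  (1987), §6.1 Prop. 6.1.4, (6.1.15); §6.2 Thm. 6.2.3–6.2.4, Prop. 6.2.5, (6.2.15), Cor. 6.2.7;
  Ch. 19. [GlimmJaffeQP1987] [GlimmJaffe1987]
* K. Osterwalder, R. Schrader, *Axioms for Euclidean Green's functions I, II*, Comm. Math. Phys. 31
  (1973) §2–§4; 42 (1975) §2. [OsterwalderSchraderCMP1973] [OsterwalderSchraderCMP1975]
-/

open scoped SchwartzMap ComplexConjugate FourierTransform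
open MeasureTheory Complex Real Set Filter Topology
open Literature.MathematicalPhysics.QuantumLattice Literature.MathematicalPhysics.AQFT
open Literature.Probability.Distributions.GaussianHermite (γm integral_coord_mul_eval_γm)

noncomputable section

namespace Literature.MathematicalPhysics.QuantumFieldTheory

/-! ### 1. Reality and hermiticity of the Schwinger functions of a measure -/

section Reality

variable {d : ℕ} [NeZero d] {μ : Measure (FieldConfig (EuclideanSpace ℝ (Fin d)))}
  {S : SchwingerFamily (EuclideanSpace ℝ (Fin d))} {n : ℕ}

omit [NeZero d] in
/-- **Reality of the Schwinger functions of a measure**: `𝔖ₙ(F*) = conj 𝔖ₙ(F)` for all `F`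
(`F*(x₁,…,xₙ) = conj F(xₙ,…,x₁)`): both sides are continuous and conjugate-linear in `F` and agree
on real tensor products, where `𝔖ₙ` is the real, permutation-symmetric moment `∫ ∏ ω(fᵢ) dμ`
(OS 1973 §2–§3, reality part of (E0)). [cite: OsterwalderSchraderCMP1973, §3 (E0)] -/
theorem _root_.Literature.MathematicalPhysics.QuantumLattice.IsSchwingerFamilyOf.apply_osStar_eq_conj
    (hS : IsSchwingerFamilyOf μ S) (n : ℕ) (G : 𝓢((Fin n → EuclideanSpace ℝ (Fin d)), ℂ)) :
    S n (osStar G) = conj (S n G) := by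
  have hcl : IsClosed {G : 𝓢((Fin n → EuclideanSpace ℝ (Fin d)), ℂ) | S n (osStar G) = conj (S n G)} :=
    isClosed_eq ((S n).continuous.comp continuous_osStar) (continuous_conj.comp (S n).continuous)
  have hsub : (Submodule.span ℂ (tensorProducts (E := EuclideanSpace ℝ (Fin d)) n) :
      Set 𝓢((Fin n → EuclideanSpace ℝ (Fin d)), ℂ)) ⊆
      {G | S n (osStar G) = conj (S n G)} := by
    intro G hG
    induction hG using Submodule.span_induction with
    | mem G hG =>
      obtain ⟨f, hf⟩ := hG
      show S n (osStar G) = conj (S n G)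
      rw [hf.unique (isTensorOf_tensorFin _), (isTensorOf_tensorFin _).osStar.unique (isTensorOf_tensorFin _),
        hS n _ _ (isTensorOf_tensorFin _), hS n _ _ (isTensorOf_tensorFin _), Complex.conj_ofReal]
      have hperm := moment_comp_perm μ Fin.revPerm f
      simp only [Fin.revPerm_apply] at hperm
      rw [hperm]
    | zero => simp
    | add G G' _ _ hG hG' =>
      show S n (osStar (G + G')) = conj (S n (G + G'))
      rw [osStar_add, map_add, map_add, map_add, hG, hG']
    | smul c G _ hG =>
      show S n (osStar (c • G)) = conj (S n (c • G))
      rw [osStar_smul, map_smul, map_smul, smul_eq_mul, smul_eq_mul, map_mul, hG]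
  have hD := (denseSpan_tensorProducts_holds (E := EuclideanSpace ℝ (Fin d)) n).closure_eq
  have hmem : G ∈ closure (Submodule.span ℂ (tensorProducts (E := EuclideanSpace ℝ (Fin d)) n) :
      Set 𝓢((Fin n → EuclideanSpace ℝ (Fin d)), ℂ)) := by rw [hD]; exact Set.mem_univ _
  exact hcl.closure_subset_iff.2 hsub hmem

/-- **Hermiticity E0 in the labelled form** for the Schwinger family of a measure with E1:
`𝔖ₙ(F) = conj 𝔖ₙ(ΘF*)` (reality `𝔖ₙ(G*) = conj 𝔖ₙ(G)` and reflection invariance `𝔖ₙ(ΘF) = 𝔖ₙ(F)`).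
[cite: OsterwalderSchraderCMP1973, §3 (E0)] -/
theorem _root_.Literature.MathematicalPhysics.QuantumLattice.IsSchwingerFamilyOf.isHermitian_toLabelled
    (hS : IsSchwingerFamilyOf μ S) (hE1 : S.IsEuclideanCovariant) : S.toLabelled.IsHermitian := by
  intro n k F _
  show S n F = conj (S n (osAdjoint F))
  rw [← osStar_thetaMulti, hS.apply_osStar_eq_conj,
    show thetaMulti d F = linActMulti (timeReflection d) F from rfl, hE1.linActMulti, Complex.conj_conj]

end Reality

/-! ### 2. Reflection positivity E2 in the labelled (finite-family) form -/

section E2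

variable {d : ℕ} [NeZero d] {μ : Measure (FieldConfig (EuclideanSpace ℝ (Fin d)))}
  {S : SchwingerFamily (EuclideanSpace ℝ (Fin d))}

/-- **E2 in the labelled form for the Schwinger functions of a measure with all moments and OS3**
(Glimm–Jaffe §6.1 (6.1.8), Prop. 6.1.4; OS 1973 (4.2)): for finitely many time-ordered `F_j` of
arbitrary degrees `deg j`, `∑ᵢⱼ 𝔖(ΘFᵢ* ⊗ Fⱼ) ≥ 0`. The OS form is continuous on the finite product of
test-function spaces, is a nonnegative real on tuples of combinations of positive-time real tensor
products (`IsSchwingerFamilyOf.sum_sum_osPairing_nonneg`), and positive-time tensor products are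
dense in the positive-time functions. [cite: GlimmJaffeQP1987, §6.1 (6.1.8) and Prop. 6.1.4] [cite: OsterwalderSchraderCMP1973, §3 (E2) and §4.1 (4.2)] -/
theorem _root_.Literature.MathematicalPhysics.QuantumLattice.IsSchwingerFamilyOf.isReflectionPositive_toLabelled
    [IsFiniteMeasure μ] (hS : IsSchwingerFamilyOf μ S) (hall : HasAllMoments μ)
    (h3 : IsOS3ReflectionPositive d μ) : S.toLabelled.IsReflectionPositive := by
  intro N deg lab F hF H hH z
  -- the OS form on the finite product of test function spaces, and its continuity
  let Φ : ((j : Fin N) → 𝓢((Fin (deg j) → EuclideanSpace ℝ (Fin d)), ℂ)) → ℂ :=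
    fun G => ∑ i, ∑ j, S.osPairing (G i) (G j)
  have hΦ : Continuous Φ := by
    refine continuous_finsetSum _ fun i _ => continuous_finsetSum _ fun j _ => ?_
    exact continuous_iff_continuousAt.2 fun G =>
      S.tendsto_osPairing ((continuous_apply i).tendsto G) ((continuous_apply j).tendsto G)
  let C : Set ℂ := {w | 0 ≤ w.re ∧ w.im = 0}
  have hC : IsClosed C :=
    (isClosed_le continuous_const Complex.continuous_re).inter
      (isClosed_eq Complex.continuous_im continuous_const)
  let A : Set ((j : Fin N) → 𝓢((Fin (deg j) → EuclideanSpace ℝ (Fin d)), ℂ)) :=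
    Set.pi Set.univ fun j => (Submodule.span ℂ (positiveTensorProducts (d := d) (deg j)) : Set _)
  have hA : A ⊆ Φ ⁻¹' C := by
    intro G hG
    have hrep : ∀ j : Fin N, ∃ (k : ℕ) (a : Fin k → ℂ)
        (v : Fin k → positiveTensorProducts (d := d) (deg j)),
        ∑ i, a i • (v i : 𝓢((Fin (deg j) → EuclideanSpace ℝ (Fin d)), ℂ)) = G j :=
      fun j => Submodule.mem_span_set'.1 (hG j (Set.mem_univ j))
    choose k a v hv using hrep
    have hv' : ∀ (j : Fin N) (i : Fin (k j)),
        ∃ f : Fin (deg j) → 𝓢(EuclideanSpace ℝ (Fin d), ℝ), (∀ l, IsPositiveTime (f l)) ∧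
          IsTensorOf (v j i : 𝓢((Fin (deg j) → EuclideanSpace ℝ (Fin d)), ℂ)) fun l => ofRealTest (f l) :=
      fun j i => (v j i).2
    choose f hf hT using hv'
    have key := hS.sum_sum_osPairing_nonneg h3 hall (ι := Σ j : Fin N, Fin (k j))
      (deg := fun p => deg p.1) (fun p => a p.1 p.2)
      (fun p => (v p.1 p.2 : 𝓢((Fin (deg p.1) → EuclideanSpace ℝ (Fin d)), ℂ)))
      (fun p => f p.1 p.2) (fun p l => hf p.1 p.2 l) (fun p => hT p.1 p.2)
    have hΦG : Φ G = ∑ p : (Σ j : Fin N, Fin (k j)), ∑ q : (Σ j : Fin N, Fin (k j)),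
        conj (a p.1 p.2) * a q.1 q.2 *
          S.osPairing (v p.1 p.2 : 𝓢((Fin (deg p.1) → EuclideanSpace ℝ (Fin d)), ℂ))
            (v q.1 q.2 : 𝓢((Fin (deg q.1) → EuclideanSpace ℝ (Fin d)), ℂ)) := by
      simp only [Φ, ← hv]
      simp only [Fintype.sum_sigma]
      refine Finset.sum_congr rfl fun i _ => ?_
      rw [Finset.sum_comm]
      refine Finset.sum_congr rfl fun j _ => ?_
      exact S.osPairing_sum_smul Finset.univ Finset.univ (a i) (a j)
        (fun l => (v i l : 𝓢((Fin (deg i) → EuclideanSpace ℝ (Fin d)), ℂ)))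
        (fun l => (v j l : 𝓢((Fin (deg j) → EuclideanSpace ℝ (Fin d)), ℂ)))
    show Φ G ∈ C
    rw [hΦG]
    exact key
  have hcl : closure A ⊆ Φ ⁻¹' C := (hC.preimage hΦ).closure_subset_iff.2 hA
  have hFmem : (fun j : Fin N => F j) ∈ closure A := by
    rw [closure_pi_set]
    exact fun j _ => IsPositiveTimeMulti.mem_closure_span_positiveTensorProducts_holds (deg j) (F j)
      (hF j).isPositiveTimeMulti
  have hres : Φ (fun j : Fin N => F j) ∈ C := hcl hFmem
  have hz : (∑ i, ∑ j, S.toLabelled (deg i + deg j) (Fin.append (lab i ∘ Fin.rev) (lab j)) (H i j)) =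
      Φ (fun j : Fin N => F j) := by
    simp only [Φ, SchwingerFamily.toLabelled_apply]
    refine Finset.sum_congr rfl fun i _ => Finset.sum_congr rfl fun j _ => ?_
    exact S.osPairing_eq_of_isAppendTensorOf (hH i j)
  show (∑ i, ∑ j, S.toLabelled (deg i + deg j) (Fin.append (lab i ∘ Fin.rev) (lab j)) (H i j)) ∈ C
  rw [hz]
  exact hres

end E2

/-! ### 3. The remaining axioms: direct transfers from the one-field forms -/

section Transfer

variable {d : ℕ} [NeZero d] {S : SchwingerFamily (EuclideanSpace ℝ (Fin d))}

omit [NeZero d] in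
/-- E0 (normalisation) transfers to the labelled form. [cite: OsterwalderSchraderCMP1973, §3 (E0)] -/
theorem isNormalized_toLabelled (hS : S.IsNormalized) : S.toLabelled.IsNormalized :=
  fun _ F => hS F

omit [NeZero d] in
/-- E3 (symmetry) transfers to the labelled form (one species: labels are constant).
[cite: OsterwalderSchraderCMP1973, §3 (E3)] -/
theorem isSymmetric_toLabelled (hS : S.IsSymmetric) : S.toLabelled.IsSymmetric :=
  fun n _ σ F _ => hS n σ F

/-- E4 (cluster property) transfers to the labelled form (time-ordered functions are positive-time).
[cite: OsterwalderSchraderCMP1973, §3 (E4)] -/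
theorem hasClusterProperty_toLabelled (hS : S.HasClusterProperty) : S.toLabelled.HasClusterProperty :=
  fun n m _ _ F G hF hG a ha0 ha H hH =>
    hS n m F G hF.isPositiveTimeMulti hG.isPositiveTimeMulti a ha0 ha H hH

omit [NeZero d] in
/-- E0' (linear growth) transfers to the labelled form (the bound holds on all of `𝒮`, a fortiori on
`⁰𝒮`). [cite: OsterwalderSchraderCMP1975, §2 (E0')] -/
theorem hasLinearGrowth_toLabelled (hS : S.HasLinearGrowth) : S.toLabelled.HasLinearGrowth := by
  intro T
  obtain ⟨s, α, β, h⟩ := (SchwingerFamily.hasLinearGrowth_iff S).1 hS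
  exact ⟨s, α, β, fun n k _ F _ => h n F⟩

end Transfer

/-! ### 4. Non-triviality: the free two-point function does not vanish at a reflected pair -/

section Nontrivial

variable {d : ℕ} [NeZero d] {m : ℝ}

/-- **Strict reflection positivity of the free covariance on a nonnegative bump**: for `m > 0` and a
real positive-time `u ≥ 0`, `u ≢ 0`, `C_m(θu, u) > 0`. In the momentum form
`C_m(θu, u) = ∫ (2ω(η))⁻¹ |G_u(η)|² dη` (Glimm–Jaffe (6.2.15), tree `freeCovariance_thetaTest_eq₂`)
the function `G_u` is continuous in `η` and `G_u(0) = ∫ e^{−m y⁰} u(y) dy > 0`.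
[cite: GlimmJaffeQP1987, Prop. 6.2.5 (6.2.15)] -/
theorem freeCovarianceReal_thetaTest_self_pos (hm : 0 < m) {u : 𝓢(EuclideanSpace ℝ (Fin d), ℝ)}
    (hu : IsPositiveTime u) (hu0 : ∀ x, 0 ≤ u x) {x₀ : EuclideanSpace ℝ (Fin d)} (hx₀ : u x₀ ≠ 0) :
    0 < freeCovarianceReal m (thetaTest d u) u := by
  obtain ⟨n, rfl⟩ : ∃ n, d = n + 1 := Nat.exists_eq_add_one_of_ne_zero (NeZero.ne d)
  have hU : IsPositiveTime (ofRealTest u) := hu.ofRealTest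
  -- abbreviations (opaque, with defining equations)
  obtain ⟨Ω, hΩ⟩ : ∃ Ω : (Fin n → ℝ) → ℝ, ∀ η, Ω η = √((2 * π) ^ 2 * ∑ j, η j ^ 2 + m ^ 2) :=
    ⟨_, fun _ => rfl⟩
  obtain ⟨Fi, hFi⟩ : ∃ Fi : (Fin n → ℝ) → EuclideanSpace ℝ (Fin (n + 1)) → ℂ, ∀ η y, Fi η y =
      (𝐞 (-∑ j, y j.succ * η j) : ℂ) * (rexp (-(Ω η * |y 0|)) : ℂ) * ofRealTest u y := ⟨_, fun _ _ => rfl⟩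
  obtain ⟨G, hG⟩ : ∃ G : (Fin n → ℝ) → ℂ, ∀ η, G η = ∫ y, Fi η y := ⟨_, fun _ => rfl⟩
  obtain ⟨I, hI⟩ : ∃ I : (Fin n → ℝ) → ℝ, ∀ η, I η = (2 * Ω η)⁻¹ * ‖G η‖ ^ 2 := ⟨_, fun _ => rfl⟩
  have hΩ0 : ∀ η, 0 ≤ Ω η := fun η => by rw [hΩ]; exact Real.sqrt_nonneg _
  have hΩpos : ∀ η, 0 < Ω η := fun η => by rw [hΩ]; exact Real.sqrt_pos.2 (by positivity)
  have hGexp : ∀ η, G η = ∫ y : EuclideanSpace ℝ (Fin (n + 1)), (𝐞 (-∑ j, y j.succ * η j) : ℂ) *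
      (rexp (-(√((2 * π) ^ 2 * ∑ j, η j ^ 2 + m ^ 2) * |y 0|)) : ℂ) * ofRealTest u y := by
    intro η; rw [hG]; simp_rw [hFi, hΩ]
  -- the momentum form of `C_m(θu, u)`
  have hC : freeCovarianceReal m (thetaTest (n + 1) u) u = ∫ η, I η := by
    have hre := integral_re (integrable_laplaceFourier_mul hm.ne' hU hU)
    simp only [RCLike.re_to_complex] at hre
    rw [freeCovarianceReal, ofRealTest_thetaTest, freeCovariance_thetaTest_eq₂ hm.ne' hU hU, ← hre]
    refine integral_congr_ae (ae_of_all _ fun η => ?_)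
    beta_reduce
    rw [Complex.conj_mul', ← Complex.ofReal_pow, ← Complex.ofReal_mul, Complex.ofReal_re, hI, hGexp, hΩ]
  -- integrability and nonnegativity of the integrand
  have hIint : Integrable I := by
    refine (integrable_laplaceFourier_mul hm.ne' hU hU).norm.congr (ae_of_all _ fun η => ?_)
    have hΩ0' : 0 ≤ (2 * √((2 * π) ^ 2 * ∑ j, η j ^ 2 + m ^ 2))⁻¹ := by positivity
    beta_reduce
    rw [hI, hGexp, hΩ, norm_mul, norm_mul, RCLike.norm_conj, Complex.norm_of_nonneg hΩ0']
    ring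
  have hI0 : 0 ≤ I := fun η => by
    rw [hI]
    exact mul_nonneg (inv_nonneg.2 (mul_nonneg zero_le_two (hΩ0 η))) (sq_nonneg _)
  -- continuity of `G` (dominated convergence)
  have hGc : Continuous G := by
    rw [show G = fun η => ∫ y, Fi η y from funext hG]
    refine continuous_of_dominated (bound := fun y => ‖ofRealTest u y‖) (fun η => ?_)
      (fun η => ae_of_all _ fun y => ?_) (ofRealTest u).integrable.norm (ae_of_all _ fun y => ?_)
    · have hc : Continuous fun y => Fi η y := by
        simp_rw [hFi, hΩ]
        fun_prop
      exact hc.aestronglyMeasurable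
    · rw [hFi, norm_mul, norm_mul, Circle.norm_coe, one_mul, Complex.norm_of_nonneg (Real.exp_pos _).le]
      have : rexp (-(Ω η * |y 0|)) ≤ 1 := Real.exp_le_one_iff.2 (by nlinarith [hΩ0 η, abs_nonneg (y 0)])
      exact mul_le_of_le_one_left (norm_nonneg _) this
    · simp_rw [hFi, hΩ]
      fun_prop
  -- `G 0 ≠ 0`
  have hG0 : G 0 ≠ 0 := by
    have hΩ0m : Ω 0 = m := by
      rw [hΩ]
      simp [Real.sqrt_sq hm.le]
    have e : ∀ y : EuclideanSpace ℝ (Fin (n + 1)), Fi 0 y = ((rexp (-(m * |y 0|)) * u y : ℝ) : ℂ) := by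
      intro y
      rw [hFi, hΩ0m]
      simp [ofRealTest_apply]
    have hG0eq : G 0 = ((∫ y : EuclideanSpace ℝ (Fin (n + 1)), rexp (-(m * |y 0|)) * u y : ℝ) : ℂ) := by
      rw [hG]
      simp_rw [e]
      exact integral_complex_ofReal
    rw [hG0eq, Complex.ofReal_ne_zero]
    apply ne_of_gt
    have hg0 : 0 ≤ fun y : EuclideanSpace ℝ (Fin (n + 1)) => rexp (-(m * |y 0|)) * u y :=
      fun y => mul_nonneg (Real.exp_pos _).le (hu0 y)
    have hgc : Continuous fun y : EuclideanSpace ℝ (Fin (n + 1)) => rexp (-(m * |y 0|)) * u y := by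
      have := u.continuous
      fun_prop
    have hgi : Integrable fun y : EuclideanSpace ℝ (Fin (n + 1)) => rexp (-(m * |y 0|)) * u y := by
      refine u.integrable.norm.mono' hgc.aestronglyMeasurable (ae_of_all _ fun y => ?_)
      rw [Real.norm_eq_abs, abs_mul, abs_of_nonneg (Real.exp_pos _).le, Real.norm_eq_abs]
      exact mul_le_of_le_one_left (abs_nonneg _) (Real.exp_le_one_iff.2 (by nlinarith [abs_nonneg (y 0)]))
    rw [integral_pos_iff_support_of_nonneg hg0 hgi]
    have hopen : IsOpen (Function.support fun y : EuclideanSpace ℝ (Fin (n + 1)) => rexp (-(m * |y 0|)) * u y) :=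
      isOpen_ne_fun hgc continuous_const
    refine hopen.measure_pos volume ⟨x₀, ?_⟩
    rw [Function.mem_support]
    exact mul_ne_zero (Real.exp_pos _).ne' hx₀
  -- positivity of the `dη`-integral
  rw [hC, integral_pos_iff_support_of_nonneg hI0 hIint]
  have hopen : IsOpen {η : Fin n → ℝ | G η ≠ 0} := isOpen_ne_fun hGc continuous_const
  have hsub : {η : Fin n → ℝ | G η ≠ 0} ⊆ Function.support I := by
    intro η hη
    rw [Function.mem_support, hI]
    exact mul_ne_zero (inv_ne_zero (mul_ne_zero two_ne_zero (hΩpos η).ne'))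
      (pow_ne_zero 2 (norm_ne_zero_iff.2 hη))
  exact lt_of_lt_of_le (hopen.measure_pos volume ⟨0, hG0⟩) (measure_mono hsub)

/-- A nonnegative, nonzero, positive-time bump on `ℝ^d` (a smooth bump around `2e₀`). [folklore] -/
private theorem exists_positiveTime_bump (d : ℕ) [NeZero d] :
    ∃ u : 𝓢(EuclideanSpace ℝ (Fin d), ℝ), IsPositiveTime u ∧ (∀ x, 0 ≤ u x) ∧
      ∃ x₀, u x₀ ≠ 0 := by
  let c : EuclideanSpace ℝ (Fin d) := EuclideanSpace.single 0 2
  let χ : ContDiffBump c := ⟨1 / 2, 1, by norm_num, by norm_num⟩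
  refine ⟨χ.hasCompactSupport.toSchwartzMap χ.contDiff, ?_, fun x => χ.nonneg, c, ?_⟩
  · intro x hx
    have hx' : x ∈ Metric.closedBall c 1 := by
      have : tsupport (χ : EuclideanSpace ℝ (Fin d) → ℝ) = Metric.closedBall c χ.rOut := χ.tsupport_eq
      rw [show ((χ.hasCompactSupport.toSchwartzMap χ.contDiff : 𝓢(EuclideanSpace ℝ (Fin d), ℝ)) :
        EuclideanSpace ℝ (Fin d) → ℝ) = χ from rfl, this] at hx
      exact hx
    rw [Metric.mem_closedBall, dist_eq_norm] at hx'
    have h1 : |(x - c) 0| ≤ ‖x - c‖ := by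
      have := PiLp.norm_apply_le (x - c) 0
      rwa [Real.norm_eq_abs] at this
    have hc0 : c 0 = 2 := by simp [c]
    have h2 : |x 0 - 2| ≤ 1 := by
      have : (x - c) 0 = x 0 - 2 := by rw [PiLp.sub_apply, hc0]
      rw [← this]; exact h1.trans hx'
    show 0 < x 0
    have := (abs_le.1 h2).1
    linarith
  · show χ c ≠ 0
    rw [χ.one_of_mem_closedBall (Metric.mem_closedBall_self (by norm_num))]
    exact one_ne_zero

variable {μ : Measure (FieldConfig (EuclideanSpace ℝ (Fin d)))} {S : SchwingerFamily (EuclideanSpace ℝ (Fin d))}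

/-- **The free field is not a c-number**: its truncated (= full, the field being centred) two-point
function is nonzero at a reflected pair of positive-time one-point test functions,
`𝔖₂(ΘF* ⊗ F) = C_m(θu, u) > 0 = 𝔖₁(ΘF*) 𝔖₁(F)` for `F = u` a nonnegative positive-time bump
(Glimm–Jaffe §6.2: the covariance of `dφ_C` is `C`, `C` reflection positive, Prop. 6.2.5).
[cite: GlimmJaffeQP1987, Prop. 6.2.5 (6.2.15)] -/
theorem _root_.Literature.MathematicalPhysics.QuantumLattice.IsFreeField.exists_truncated_two_point_ne
    (hm : 0 < m) (h : IsFreeField m μ) (hS : IsSchwingerFamilyOf μ S) :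
    ∃ (F₁ G₁ : 𝓢((Fin 1 → EuclideanSpace ℝ (Fin d)), ℂ))
      (H₁ : 𝓢((Fin (1 + 1) → EuclideanSpace ℝ (Fin d)), ℂ)),
      IsTimeOrdered F₁ ∧ IsTimeOrdered G₁ ∧ IsAppendTensorOf H₁ (osAdjoint F₁) G₁ ∧
        S (1 + 1) H₁ ≠ S 1 (osAdjoint F₁) * S 1 G₁ := by
  haveI : ProbabilityTheory.IsGaussian μ := h.1.1
  have hμ : HasAllMoments μ := fun p φ => h.1.memLp_eval φ p ENNReal.coe_ne_top
  obtain ⟨u, hu, hu0, x₀, hx₀⟩ := exists_positiveTime_bump d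
  set F : 𝓢((Fin 1 → EuclideanSpace ℝ (Fin d)), ℂ) := SchwartzMap.tensorFin 1 fun _ => ofRealTest u with hF
  have hT : IsTensorOf F fun _ => ofRealTest u := isTensorOf_tensorFin _
  have hFt : IsTimeOrdered F :=
    (SchwingerFamily.isTimeOrdered_iff_isPositiveTimeMulti_one F).2
      (IsPositiveTimeMulti.of_mem_positiveTensorProducts ⟨fun _ => u, fun _ => hu, hT⟩)
  refine ⟨F, F, (osAdjoint F).appendTensor F, hFt, hFt, isAppendTensorOf_appendTensor _ _, ?_⟩
  have h1 : S 1 F = 0 := by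
    rw [hS 1 (fun _ => u) F hT, moment]
    simp [(h.1.2 u).2]
  have h2 : S (1 + 1) ((osAdjoint F).appendTensor F) = (freeCovarianceReal m (thetaTest d u) u : ℂ) := by
    have := hS.osPairing_tensor hT hT
    rw [SchwingerFamily.osPairing] at this
    rw [this, ← h.integral_eval_mul_eval hm.ne' hμ, ← integral_complex_ofReal]
    refine integral_congr_ae (ae_of_all _ fun ω => ?_)
    simp
  rw [h1, mul_zero, h2, Complex.ofReal_ne_zero]
  exact (freeCovarianceReal_thetaTest_self_pos hm hu hu0 hx₀).ne'

end Nontrivial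

/-! ### 5. Assembly -/

/-- **Discharge of `IsotropicOSFamilyExists`**: the Schwinger family of the free scalar field of mass
`1` on `ℝ⁴` (`freeFieldMeasure 4 1`, Glimm–Jaffe §6.2) is a normalised, hermitian, linearly growing,
reflection-positive, symmetric, clustering, fully Euclidean-invariant one-field family with mass gap
`1` for all truncations and a non-vanishing truncated two-point function.
[cite: GlimmJaffe1987, §6.2 Thm. 6.2.4 and Ch. 19] [cite: GlimmJaffeQP1987, §6.2 Thm. 6.2.3–6.2.4, Prop. 6.2.5] -/
theorem isotropicOSFamilyExists_holds : IsotropicOSFamilyExists := by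
  have hm : (0 : ℝ) < 1 := one_pos
  have h : IsFreeField 1 (freeFieldMeasure 4 1) := freeFieldMeasure_spec_holds 4 hm
  have hOSμ : IsOSMeasure 4 (freeFieldMeasure 4 1) := IsFreeField.isOSMeasure_holds h hm
  haveI := hOSμ.isProbabilityMeasure
  obtain ⟨S, hS, hOS, -⟩ := IsOSMeasure.exists_isOSFamily'_holds hOSμ
  have hlin : S.HasLinearGrowth :=
    SchwingerFamily.HasProductGrowth.hasLinearGrowth_holds (hOSμ.hasProductGrowth hS)
  exact ⟨S, isNormalized_toLabelled hOS.normalized, hS.isHermitian_toLabelled hOS.covariant,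
    hasLinearGrowth_toLabelled hlin,
    hS.isReflectionPositive_toLabelled hOSμ.hasAllMoments hOSμ.os3, isSymmetric_toLabelled hOS.symmetric,
    hasClusterProperty_toLabelled hOS.cluster, fun n a F _ => hOS.covariant.1 n a F,
    fun R n F _ => hOS.covariant.2 n R F, ⟨1, hm, h.hasMassGap_toLabelled hm hS hOS.covariant⟩,
    h.exists_truncated_two_point_ne hm hS⟩

/-- **General form** (the `TODO(general form)` of `IsotropicOSFamilyExists`: every dimension `d ≥ 1`
and every mass `m > 0`): the free scalar field measure `freeFieldMeasure d m` has a Schwinger family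
with all the clauses of `IsotropicOSFamilyExists` on `ℝ^d`, the mass gap being `m` itself
(Glimm–Jaffe §6.2, Thm. 6.2.3–6.2.4). [cite: GlimmJaffeQP1987, §6.2 Thm. 6.2.3–6.2.4, Prop. 6.2.5] -/
theorem exists_isotropicOSFamily_freeField (d : ℕ) [NeZero d] {m : ℝ} (hm : 0 < m) :
    ∃ S : SchwingerFamily (EuclideanSpace ℝ (Fin d)),
      IsSchwingerFamilyOf (freeFieldMeasure d m) S ∧ S.IsOSFamily ∧
      S.toLabelled.IsNormalized ∧ S.toLabelled.IsHermitian ∧ S.toLabelled.HasLinearGrowth ∧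
      S.toLabelled.IsReflectionPositive ∧ S.toLabelled.IsSymmetric ∧ S.toLabelled.HasClusterProperty ∧
      (∀ (n : ℕ) (a : EuclideanSpace ℝ (Fin d)) (F : 𝓢((Fin n → EuclideanSpace ℝ (Fin d)), ℂ)),
        IsOffDiagonal F → S n (translateMulti a F) = S n F) ∧
      (∀ (R : EuclideanSpace ℝ (Fin d) ≃ₗᵢ[ℝ] EuclideanSpace ℝ (Fin d)) (n : ℕ)
        (F : 𝓢((Fin n → EuclideanSpace ℝ (Fin d)), ℂ)), IsOffDiagonal F → S n (linActMulti R F) = S n F) ∧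
      S.MassGapOS m ∧ S.toLabelled.HasMassGap m ∧
      ∃ (F₁ G₁ : 𝓢((Fin 1 → EuclideanSpace ℝ (Fin d)), ℂ))
        (H₁ : 𝓢((Fin (1 + 1) → EuclideanSpace ℝ (Fin d)), ℂ)),
        IsTimeOrdered F₁ ∧ IsTimeOrdered G₁ ∧ IsAppendTensorOf H₁ (osAdjoint F₁) G₁ ∧
          S (1 + 1) H₁ ≠ S 1 (osAdjoint F₁) * S 1 G₁ := by
  have h : IsFreeField m (freeFieldMeasure d m) := freeFieldMeasure_spec_holds d hm
  have hOSμ : IsOSMeasure d (freeFieldMeasure d m) := IsFreeField.isOSMeasure_holds h hm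
  haveI := hOSμ.isProbabilityMeasure
  obtain ⟨S, hS, hOS, -⟩ := IsOSMeasure.exists_isOSFamily'_holds hOSμ
  have hlin : S.HasLinearGrowth :=
    SchwingerFamily.HasProductGrowth.hasLinearGrowth_holds (hOSμ.hasProductGrowth hS)
  exact ⟨S, hS, hOS, isNormalized_toLabelled hOS.normalized, hS.isHermitian_toLabelled hOS.covariant,
    hasLinearGrowth_toLabelled hlin,
    hS.isReflectionPositive_toLabelled hOSμ.hasAllMoments hOSμ.os3, isSymmetric_toLabelled hOS.symmetric,
    hasClusterProperty_toLabelled hOS.cluster, fun n a F _ => hOS.covariant.1 n a F,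
    fun R n F _ => hOS.covariant.2 n R F, h.massGapOS hm hS hOS.covariant,
    h.hasMassGap_toLabelled hm hS hOS.covariant, h.exists_truncated_two_point_ne hm hS⟩

/-! ### 6. The free scalar field as `OSData`: a non-trivial inhabitant with a mass gap -/

section FreeFieldOSData

variable {d : ℕ} [NeZero d] {S : SchwingerFamily (EuclideanSpace ℝ (Fin d))}

omit [NeZero d] in
/-- E1 in the labelled (restricted: translations and proper rotations on `⁰𝒮`) form from full
one-field Euclidean covariance. [cite: OsterwalderSchraderCMP1973, §3 (E1)] -/
theorem isEuclideanInvariant_toLabelled (hS : S.IsEuclideanCovariant) :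
    S.toLabelled.IsEuclideanInvariant :=
  ⟨fun n _ a F _ => hS.translateMulti n a F, fun n _ R _ F _ => hS.linActMulti n R F⟩

variable (d) in
/-- **The Schwinger family of the free scalar field of mass `m > 0` on `ℝ^d`** (a choice of the
family of `exists_isotropicOSFamily_freeField`: the moments of `freeFieldMeasure d m`, extended
complex-multilinearly and by density to `𝒮(ℝ^{dn})`; Glimm–Jaffe §6.2).
[cite: GlimmJaffeQP1987, §6.2 Thm. 6.2.3–6.2.4] -/
def freeFieldSchwinger {m : ℝ} (hm : 0 < m) : SchwingerFamily (EuclideanSpace ℝ (Fin d)) :=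
  Classical.choose (exists_isotropicOSFamily_freeField d hm)

/-- The defining properties of `freeFieldSchwinger d hm`. [cite: GlimmJaffeQP1987, §6.2 Thm. 6.2.3–6.2.4, Prop. 6.2.5] -/
theorem freeFieldSchwinger_spec {m : ℝ} (hm : 0 < m) :
    IsSchwingerFamilyOf (freeFieldMeasure d m) (freeFieldSchwinger d hm) ∧
      (freeFieldSchwinger d hm).IsOSFamily ∧
      (freeFieldSchwinger d hm).toLabelled.IsNormalized ∧ (freeFieldSchwinger d hm).toLabelled.IsHermitian ∧
      (freeFieldSchwinger d hm).toLabelled.HasLinearGrowth ∧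
      (freeFieldSchwinger d hm).toLabelled.IsReflectionPositive ∧ (freeFieldSchwinger d hm).toLabelled.IsSymmetric ∧
      (freeFieldSchwinger d hm).toLabelled.HasClusterProperty ∧
      (∀ (n : ℕ) (a : EuclideanSpace ℝ (Fin d)) (F : 𝓢((Fin n → EuclideanSpace ℝ (Fin d)), ℂ)),
        IsOffDiagonal F → freeFieldSchwinger d hm n (translateMulti a F) = freeFieldSchwinger d hm n F) ∧
      (∀ (R : EuclideanSpace ℝ (Fin d) ≃ₗᵢ[ℝ] EuclideanSpace ℝ (Fin d)) (n : ℕ)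
        (F : 𝓢((Fin n → EuclideanSpace ℝ (Fin d)), ℂ)), IsOffDiagonal F →
          freeFieldSchwinger d hm n (linActMulti R F) = freeFieldSchwinger d hm n F) ∧
      (freeFieldSchwinger d hm).MassGapOS m ∧ (freeFieldSchwinger d hm).toLabelled.HasMassGap m ∧
      ∃ (F₁ G₁ : 𝓢((Fin 1 → EuclideanSpace ℝ (Fin d)), ℂ))
        (H₁ : 𝓢((Fin (1 + 1) → EuclideanSpace ℝ (Fin d)), ℂ)),
        IsTimeOrdered F₁ ∧ IsTimeOrdered G₁ ∧ IsAppendTensorOf H₁ (osAdjoint F₁) G₁ ∧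
          freeFieldSchwinger d hm (1 + 1) H₁ ≠
            freeFieldSchwinger d hm 1 (osAdjoint F₁) * freeFieldSchwinger d hm 1 G₁ :=
  Classical.choose_spec (exists_isotropicOSFamily_freeField d hm)

/-- `freeFieldSchwinger d hm` is the Schwinger family of `freeFieldMeasure d m`. [cite: GlimmJaffeQP1987, §6.2 Thm. 6.2.3] -/
theorem isSchwingerFamilyOf_freeFieldSchwinger {m : ℝ} (hm : 0 < m) :
    IsSchwingerFamilyOf (freeFieldMeasure d m) (freeFieldSchwinger d hm) :=
  (freeFieldSchwinger_spec hm).1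

/-- `freeFieldSchwinger d hm` satisfies the one-field OS axioms E0–E4. [cite: GlimmJaffeQP1987, §6.2 Thm. 6.2.3] -/
theorem isOSFamily_freeFieldSchwinger {m : ℝ} (hm : 0 < m) : (freeFieldSchwinger d hm).IsOSFamily :=
  (freeFieldSchwinger_spec hm).2.1

/-- `freeFieldSchwinger d hm` has the OS mass gap `m` (all truncations). [cite: GlimmJaffeQP1987, §6.2 Thm. 6.2.4, Cor. 6.2.7] -/
theorem massGapOS_freeFieldSchwinger {m : ℝ} (hm : 0 < m) : (freeFieldSchwinger d hm).MassGapOS m :=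
  (freeFieldSchwinger_spec hm).2.2.2.2.2.2.2.2.2.2.1

variable (d) in
/-- **The free scalar field of mass `m > 0` on `ℝ^d` as OS data** (one species, `ι = Unit`): the
labelled family of `freeFieldSchwinger d hm` with the full axiom set E0', E0–E4 (Glimm–Jaffe §6.2,
Thm. 6.2.3). A NON-trivial inhabitant of `OSData Unit d` (compare `OSData.vacuum`): it has the mass
gap `m` (`freeFieldOSData_hasMassGap`) and a non-vanishing truncated two-point function
(`freeFieldOSData_isNontrivial`), so the clauses `HasMassGap Δ ∧ IsNontrivial` of the summit
statements are jointly satisfiable; being Gaussian it is of course not `IsNonGaussian`.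
[cite: GlimmJaffeQP1987, §6.2 Thm. 6.2.3–6.2.4] -/
def freeFieldOSData {m : ℝ} (hm : 0 < m) : OSData Unit d :=
  OSData.ofAxioms (freeFieldSchwinger d hm).toLabelled
    { normalized := (freeFieldSchwinger_spec hm).2.2.1
      hermitian := (freeFieldSchwinger_spec hm).2.2.2.1
      invariant := isEuclideanInvariant_toLabelled (freeFieldSchwinger_spec hm).2.1.covariant
      reflectionPositive := (freeFieldSchwinger_spec hm).2.2.2.2.2.1
      symmetric := (freeFieldSchwinger_spec hm).2.2.2.2.2.2.1
      cluster := (freeFieldSchwinger_spec hm).2.2.2.2.2.2.2.1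
      linearGrowth := (freeFieldSchwinger_spec hm).2.2.2.2.1 }

/-- The Schwinger functions of `freeFieldOSData d hm` are those of `freeFieldSchwinger d hm`
(labels forgotten). [cite: GlimmJaffeQP1987, §6.2 Thm. 6.2.3] -/
@[simp] theorem freeFieldOSData_schwinger {m : ℝ} (hm : 0 < m) (n : ℕ) (k : Fin n → Unit) :
    (freeFieldOSData d hm).schwinger n k = freeFieldSchwinger d hm n := rfl

/-- **The free field has the mass gap `m`** (as `OSData`). [cite: GlimmJaffeQP1987, §6.2 Thm. 6.2.4, Cor. 6.2.7] -/
theorem freeFieldOSData_hasMassGap {m : ℝ} (hm : 0 < m) : (freeFieldOSData d hm).HasMassGap m :=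
  (freeFieldSchwinger_spec hm).2.2.2.2.2.2.2.2.2.2.2.1

/-- **The free field is non-trivial** in the sense of `OSData.IsNontrivial` (its truncated two-point
function does not vanish at a reflected pair). [cite: GlimmJaffeQP1987, §6.2 Prop. 6.2.5] -/
theorem freeFieldOSData_isNontrivial {m : ℝ} (hm : 0 < m) : (freeFieldOSData d hm).IsNontrivial () :=
  (freeFieldSchwinger_spec hm).2.2.2.2.2.2.2.2.2.2.2.2

/-- Hence `OSData` with a mass gap need not be the vacuum-only theory: `HasMassGap m ∧ IsNontrivial`
is satisfiable for every `d ≥ 1`, `m > 0`. [cite: GlimmJaffeQP1987, §6.2 Thm. 6.2.3–6.2.4] -/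
theorem exists_osData_hasMassGap_isNontrivial (d : ℕ) [NeZero d] {m : ℝ} (hm : 0 < m) :
    ∃ T : OSData Unit d, T.HasMassGap m ∧ T.IsNontrivial () :=
  ⟨freeFieldOSData d hm, freeFieldOSData_hasMassGap hm, freeFieldOSData_isNontrivial hm⟩

end FreeFieldOSData

/-! ### 7. The free field is Gaussian: odd Schwinger functions vanish, `¬ IsNonGaussian` -/

section OddMoments

variable {σ : Type*} [Fintype σ] [DecidableEq σ]

/-- First moments of a centred multivariate Gaussian vanish (Stein's identity with `G = 1`). [folklore] -/
private theorem integral_coord_γm_eq_zero {S : Matrix σ σ ℝ} (hS : S.PosSemidef) (a : σ) :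
    ∫ z, z a ∂γm S = 0 := by
  have h := integral_coord_mul_eval_γm hS (1 : MvPolynomial σ ℝ) a
  simp only [map_one, mul_one, MvPolynomial.pderiv_one, map_zero, integral_zero, mul_zero,
    Finset.sum_const_zero] at h
  exact h

/-- Third moments of a centred multivariate Gaussian vanish (Stein's identity with `G = X_b X_c`,
then the first moments). [folklore] -/
private theorem integral_coord_mul_coord_mul_coord_γm_eq_zero {S : Matrix σ σ ℝ} (hS : S.PosSemidef)
    (a b c : σ) : ∫ z, z a * (z b * z c) ∂γm S = 0 := by
  have h := integral_coord_mul_eval_γm hS (MvPolynomial.X b * MvPolynomial.X c) a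
  simp only [map_mul, MvPolynomial.eval_X] at h
  rw [h]
  refine Finset.sum_eq_zero fun e _ => mul_eq_zero_of_right _ ?_
  simp only [MvPolynomial.pderiv_mul, map_add, map_mul, MvPolynomial.eval_X]
  haveI : ProbabilityTheory.IsGaussian (γm S) := by unfold γm; infer_instance
  have hib : Integrable (fun z : EuclideanSpace ℝ σ => z b) (γm S) := by
    simpa using integrable_eval_mvPolynomial (γm S) (MvPolynomial.X b)
  have hic : Integrable (fun z : EuclideanSpace ℝ σ => z c) (γm S) := by
    simpa using integrable_eval_mvPolynomial (γm S) (MvPolynomial.X c)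
  by_cases hb : b = e
  · subst hb
    by_cases hc : c = b
    · subst hc
      simp only [MvPolynomial.pderiv_X_self, map_one, one_mul, mul_one]
      rw [integral_add hib hib, integral_coord_γm_eq_zero hS, add_zero]
    · simp only [MvPolynomial.pderiv_X_self, map_one, one_mul, MvPolynomial.pderiv_X_of_ne hc, map_zero,
        mul_zero, add_zero]
      exact integral_coord_γm_eq_zero hS c
  · by_cases hc : c = e
    · subst hc
      simp only [MvPolynomial.pderiv_X_of_ne hb, map_zero, zero_mul, zero_add, MvPolynomial.pderiv_X_self,
        map_one, mul_one]
      exact integral_coord_γm_eq_zero hS b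
    · simp only [MvPolynomial.pderiv_X_of_ne hb, MvPolynomial.pderiv_X_of_ne hc, map_zero, zero_mul,
        mul_zero, add_zero, integral_zero]

end OddMoments

section FreeOdd

variable {d : ℕ} {m : ℝ} {μ : Measure (FieldConfig (EuclideanSpace ℝ (Fin d)))}
  {S : SchwingerFamily (EuclideanSpace ℝ (Fin d))}

/-- **The free field has vanishing third moments**: `∫ ω(f₀) ω(f₁) ω(f₂) dμ = 0` (centred Gaussian;
Glimm–Jaffe §6.2 / Prop. 6.2.2 with (6.2.4)). [cite: GlimmJaffeQP1987, §6.2 (6.2.4)] -/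
theorem _root_.Literature.MathematicalPhysics.QuantumLattice.IsFreeField.moment_three_eq_zero (hm : m ≠ 0)
    (h : IsFreeField m μ) (f : Fin 3 → 𝓢(EuclideanSpace ℝ (Fin d), ℝ)) : moment μ 3 f = 0 := by
  have key := h.integral_comp_evalVec hm f (Φ := fun z => z 0 * (z 1 * z 2)) (by fun_prop)
  rw [moment]
  have e : ∀ ω : FieldConfig (EuclideanSpace ℝ (Fin d)),
      (∏ i, ω (f i)) = (evalVec f ω) 0 * ((evalVec f ω) 1 * (evalVec f ω) 2) := by
    intro ω
    rw [Fin.prod_univ_three, mul_assoc]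
    rfl
  simp_rw [e]
  rw [key]
  exact integral_coord_mul_coord_mul_coord_γm_eq_zero (posSemidef_covGram hm f) 0 1 2

/-- **The free field is centred**: `∫ ω(f) dμ = 0`, as the first moment. [cite: GlimmJaffeQP1987, §6.2 (6.2.4)] -/
theorem _root_.Literature.MathematicalPhysics.QuantumLattice.IsFreeField.moment_one_eq_zero
    (h : IsFreeField m μ) (f : Fin 1 → 𝓢(EuclideanSpace ℝ (Fin d), ℝ)) : moment μ 1 f = 0 := by
  rw [moment]
  simp [(h.1.2 (f 0)).2]

/-- A Schwinger family of a measure vanishes identically in degree `n` as soon as all real moments of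
degree `n` vanish (density of real tensor products). [folklore] -/
private theorem apply_eq_zero_of_moment_eq_zero (hS : IsSchwingerFamilyOf μ S) {n : ℕ}
    (h0 : ∀ f : Fin n → 𝓢(EuclideanSpace ℝ (Fin d), ℝ), moment μ n f = 0)
    (G : 𝓢((Fin n → EuclideanSpace ℝ (Fin d)), ℂ)) : S n G = 0 := by
  have hcl : IsClosed {G : 𝓢((Fin n → EuclideanSpace ℝ (Fin d)), ℂ) | S n G = 0} :=
    isClosed_eq (S n).continuous continuous_const
  have hsub : (Submodule.span ℂ (tensorProducts (E := EuclideanSpace ℝ (Fin d)) n) :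
      Set 𝓢((Fin n → EuclideanSpace ℝ (Fin d)), ℂ)) ⊆ {G | S n G = 0} := by
    intro G hG
    induction hG using Submodule.span_induction with
    | mem G hG =>
      obtain ⟨f, hf⟩ := hG
      show S n G = 0
      rw [hS n f G hf, h0 f, Complex.ofReal_zero]
    | zero => simp
    | add G G' _ _ hG hG' =>
      show S n (G + G') = 0
      rw [map_add, hG, hG', add_zero]
    | smul c G _ hG =>
      show S n (c • G) = 0
      rw [map_smul, hG, smul_zero]
  have hD := (denseSpan_tensorProducts_holds (E := EuclideanSpace ℝ (Fin d)) n).closure_eq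
  have hmem : G ∈ closure (Submodule.span ℂ (tensorProducts (E := EuclideanSpace ℝ (Fin d)) n) :
      Set 𝓢((Fin n → EuclideanSpace ℝ (Fin d)), ℂ)) := by rw [hD]; exact Set.mem_univ _
  exact hcl.closure_subset_iff.2 hsub hmem

/-- **All Schwinger functions of degree 3 of the free field vanish.** [cite: GlimmJaffeQP1987, §6.2 (6.2.4)] -/
theorem _root_.Literature.MathematicalPhysics.QuantumLattice.IsFreeField.apply_three_eq_zero (hm : m ≠ 0)
    (h : IsFreeField m μ) (hS : IsSchwingerFamilyOf μ S)
    (G : 𝓢((Fin 3 → EuclideanSpace ℝ (Fin d)), ℂ)) : S 3 G = 0 :=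
  apply_eq_zero_of_moment_eq_zero hS (h.moment_three_eq_zero hm) G

/-- **All Schwinger functions of degree 1 of the free field vanish.** [cite: GlimmJaffeQP1987, §6.2 (6.2.4)] -/
theorem _root_.Literature.MathematicalPhysics.QuantumLattice.IsFreeField.apply_one_eq_zero
    (h : IsFreeField m μ) (hS : IsSchwingerFamilyOf μ S)
    (G : 𝓢((Fin 1 → EuclideanSpace ℝ (Fin d)), ℂ)) : S 1 G = 0 :=
  apply_eq_zero_of_moment_eq_zero hS h.moment_one_eq_zero G

end FreeOdd

section NotNonGaussian

variable {d : ℕ} [NeZero d]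

/-- **The free field is not `IsNonGaussian`**: its connected three-point function vanishes
identically (indeed `𝔖₁ = 𝔖₃ = 0`), so the clause `IsNonGaussian` of the summit statements does
exclude it — while it passes `IsNontrivial` and `HasMassGap` (`freeFieldOSData_isNontrivial`,
`freeFieldOSData_hasMassGap`). [cite: GlimmJaffeQP1987, §6.2 (6.2.4)] -/
theorem not_isNonGaussian_freeFieldOSData {m : ℝ} (hm : 0 < m) :
    ¬(freeFieldOSData d hm).IsNonGaussian () := by
  rintro ⟨f, g, k, Ffgh, Fgh, Ffh, Ffg, Ff, Fg, Fh, -, -, -, -, -, -, -, -, hne⟩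
  apply hne
  have h : IsFreeField m (freeFieldMeasure d m) := freeFieldMeasure_spec_holds d hm
  have hS : IsSchwingerFamilyOf (freeFieldMeasure d m) (freeFieldSchwinger d hm) :=
    isSchwingerFamilyOf_freeFieldSchwinger hm
  simp [freeFieldOSData_schwinger, h.apply_three_eq_zero hm.ne' hS, h.apply_one_eq_zero hS]

end NotNonGaussian

end Literature.MathematicalPhysics.QuantumFieldTheory
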